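import Summits.BirchSwinnertonDyer.Uniform.U2.TransportA
import Summits.BirchSwinnertonDyer.Uniform.U2.RouteBAssembly
import HarnessLib

/-!
# Track U2 (cell `bsd-uniform`), routes A + B composed: `BSD(E^{(d)}, 2) ∧ BSD(E^{(dD)}, 2)` for the
# RANK-ONE base with the two Selmer transports DISCHARGED by Mazur–Rubin 2010 Cor. 3.4 (ii)

HONEST FRAMING (cell `bsd-uniform`, HOME run/shared/lean/pub/bsd-uniform/, seat u2-p1; verbatim in every
file of the seat): a RELATIVE (twist-transport) theorem; converts PAIRS, never the class X5; books
nothing; no per-curve certificate counted as uniform. This file is pure COMPOSITION: u2-p2's end-to-end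
route-B theorem `bsdp_two_genusPair_rankOne_noFlip` (`RouteBAssembly.lean`) takes «route A's two
Selmer transports» as binders `hSel₁ : #Sel₂(E^{(d)}) = #Sel₂(E)`, `hSel₂ : #Sel₂(E^{(dD)}) = #Sel₂(E^{(D)})`;
here they are DISCHARGED by the printed control theorem (named fact
`MazurRubin2010.cor34ii_rat`, Invent. Math. 181 (2010) Cor. 3.4 (ii), typed AS PRINTED) under its
Prop. 3.3 reduction-type binders for BOTH bases `E` and `E^{(D)}` at `F = ℚ(√d)`: additive primes
split in `F` (for `E^{(D)}` these include the primes of `D`: condition (C-p) of T4-PROOF §6 in its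
first alternative), multiplicative even-`ord(Δ)` primes split, `2` splits (`d ≡ 1 (mod 8)`), `F` real
if `Δ > 0`, odd-`ord(Δ)` multiplicative primes unramified, `E(ℚ_q)[2] = 0` / `E^{(D)}(ℚ_q)[2] = 0` at
the primes `q ∣ d` (`a_q` odd). Every OTHER binder is u2-p2's, unchanged and grouped as there
(modularity / parity / GZK named facts; the genus-point + explicit-Gross–Zagier input `hGZ`; (H-2);
`Ш[2] = 0` of the base pair; the (※) identity with odd indices; Tamagawa balance; base certificates
`BSDp W 2`, `BSDp W₀ 2`; Zhai's unit for the rank-`0` member). What remains per-base is listed in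
HOME/RESIDUE.md (R2-1, R-A1…R-A7, R-B*). NO Cassels–Tate input is needed on this path (route B derives
`Ш[2] = 0` from the Selmer counts and the analytic ranks).

## Contents
* `bsdp_two_genusPair_rankOne_noFlip_of_mazurRubin` — `BSDp W₁ 2 ∧ BSDp W₂ 2 ∧ r_an(W₁) = 1 ∧
  r_an(W₂) = 0` for the genus pair `(W₁, W₂) ≅ (E^{(d)}, E^{(dD)})` of a rank-one base `E`.

References: Mazur–Rubin 2010 Cor. 3.4 (ii) [MazurRubin2010]; Kriz–Li 2019 Thm. 1.12 (2) (the split-prime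
(★) instance of the same assembly) [KrizLi2019]; Zhai 2016 [Zhai2016]; Miller 2011 Def. 1.1
[Miller2011LMS]; `p2/idea-2/T4-PROOF.md` v1.9b §§4–7.
-/

noncomputable section

open scoped Classical NumberTheorySymbols

open NumberField WeierstrassCurve Literature.NumberTheory.EllipticCurves
  Literature.NumberTheory.EllipticCurves.ModularForms

namespace Summit.BirchSwinnertonDyer.Uniform.U2

/-- **ROUTES A + B, END-TO-END (rank-one base, no flip), Selmer transports discharged by
Mazur–Rubin.** Binders: u2-p2's `bsdp_two_genusPair_rankOne_noFlip` minus `hSel₁`, `hSel₂`, plus the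
named fact `hMR : MazurRubin2010.cor34ii_rat`, a quadratic field `F ∋ √d` (`d` square-free, `≠ 1`), the
twist relation `W₂ ≅ W₀^{(d)}` (`W₀` a model of `E^{(D)}`), and Mazur–Rubin's Prop. 3.3 binders for `W`
and for `W₀` at `F`. Conclusion: `BSD(W₁, 2)`, `BSD(W₂, 2)`, `r_an(W₁) = 1`, `r_an(W₂) = 0`.
[cite: MazurRubin2010, Cor. 3.4 (ii) with Prop. 3.3] [cite: Zhai2016, Thm. 1.1 and 1.2 (binder hZhai)]
[cite: Miller2011LMS, Def. 1.1] -/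
theorem bsdp_two_genusPair_rankOne_noFlip_of_mazurRubin
    (W W₀ W₁ W₂ : WeierstrassCurve ℚ) [W.IsElliptic] [W₀.IsElliptic] [W₁.IsElliptic] [W₂.IsElliptic]
    -- named facts: Mazur–Rubin control; modularity, parity, GZK
    (hMR : MazurRubin2010.cor34ii_rat)
    (hmod : exists_isNewformOf) (hE : hasEntireLFunction_rat)
    (hpar : ∀ V : WeierstrassCurve ℚ, V.even_analyticRank_iff)
    (hGZK : rank_eq_analyticRank_of_analyticRank_le_one)
    -- the twisting data and the models
    {d D : ℤ} (hd4 : d % 4 = 1) (hD4 : D % 4 = 1) (hsqf : Squarefree (d * D))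
    (hgcd : Int.gcd (d * D) (W.conductorNorm ℤ) = 1)
    (hχ : J(-1 | D.natAbs) * J((W.conductorNorm ℤ : ℤ) | D.natAbs) = -1)
    (h₁ : ∃ C : VariableChange ℚ, C • W₁ = W.quadraticTwist (d : ℚ))
    (h₂ : ∃ C : VariableChange ℚ, C • W₂ = W.quadraticTwist ((d * D : ℤ) : ℚ))
    (h₂' : ∃ C : VariableChange ℚ, C • W₂ = W₀.quadraticTwist (d : ℚ))
    (hr : W.analyticRank = 1) (hr₀ : W₀.analyticRank = 0)
    (hsign : Int.sign d * J((W.conductorNorm ℤ : ℤ) | d.natAbs) = 1)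
    (hGZ : deriv (fun s => (W.quadraticTwist (d : ℚ)).entireLFunction s *
        (W.quadraticTwist ((d * D : ℤ) : ℚ)).entireLFunction s) 1 ≠ 0)
    -- Mazur–Rubin Prop. 3.3 binders at `F = ℚ(√d)`, for `E` (model `W`) and for `E^{(D)}` (model `W₀`)
    (hd : Squarefree d) (hd1 : d ≠ 1)
    (F : Type) [Field F] [NumberField F] (hF : Module.finrank ℚ F = 2) (hx : ∃ x : F, x ^ 2 = (d : F))
    (h2F : ((Ideal.span {(2 : ℤ)}).primesOver (𝓞 F)).ncard = 2)
    (hadd : ∀ (p : ℕ) [Fact p.Prime], ¬ W.HasGoodReductionAtPrime p →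
      ¬ W.HasMultiplicativeReductionAtPrime p → ((Ideal.span {(p : ℤ)}).primesOver (𝓞 F)).ncard = 2)
    (hmev : ∀ (p : ℕ) [Fact p.Prime], W.HasMultiplicativeReductionAtPrime p →
      Even (padicValRat p W.Δ) → ((Ideal.span {(p : ℤ)}).primesOver (𝓞 F)).ncard = 2)
    (hreal : 0 < W.Δ → NumberField.IsTotallyReal F)
    (hmodd : ∀ (p : ℕ) [Fact p.Prime], W.HasMultiplicativeReductionAtPrime p →
      Odd (padicValRat p W.Δ) → ¬ (p : ℤ) ∣ NumberField.discr F)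
    (hTq : ∀ (p : ℕ) [Fact p.Prime], (p : ℤ) ∣ NumberField.discr F →
      ∀ Q : (W.baseChange ℚ_[p]).toAffine.Point, 2 • Q = 0 → Q = 0)
    (hadd₀ : ∀ (p : ℕ) [Fact p.Prime], ¬ W₀.HasGoodReductionAtPrime p →
      ¬ W₀.HasMultiplicativeReductionAtPrime p → ((Ideal.span {(p : ℤ)}).primesOver (𝓞 F)).ncard = 2)
    (hmev₀ : ∀ (p : ℕ) [Fact p.Prime], W₀.HasMultiplicativeReductionAtPrime p →
      Even (padicValRat p W₀.Δ) → ((Ideal.span {(p : ℤ)}).primesOver (𝓞 F)).ncard = 2)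
    (hreal₀ : 0 < W₀.Δ → NumberField.IsTotallyReal F)
    (hmodd₀ : ∀ (p : ℕ) [Fact p.Prime], W₀.HasMultiplicativeReductionAtPrime p →
      Odd (padicValRat p W₀.Δ) → ¬ (p : ℤ) ∣ NumberField.discr F)
    (hTq₀ : ∀ (p : ℕ) [Fact p.Prime], (p : ℤ) ∣ NumberField.discr F →
      ∀ Q : (W₀.baseChange ℚ_[p]).toAffine.Point, 2 • Q = 0 → Q = 0)
    -- (H-2) for the four curves; `Ш[2] = 0` for the base pair
    (hT : ∀ P : W.toAffine.Point, 2 • P = 0 → P = 0)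
    (hT₀ : ∀ P : W₀.toAffine.Point, 2 • P = 0 → P = 0)
    (hT₁ : ∀ P : W₁.toAffine.Point, 2 • P = 0 → P = 0)
    (hT₂ : ∀ P : W₂.toAffine.Point, 2 • P = 0 → P = 0)
    (hSha : ∀ x : W.galH1, x ∈ W.sha → 2 • x = 0 → x = 0)
    (hSha₀ : ∀ x : W₀.galH1, x ∈ W₀.sha → 2 • x = 0 → x = 0)
    -- (※) with its odd indices, odd torsion, Tamagawa balance
    {n m : ℕ} (hn : Odd n) (hm : Odd m)
    (hId : shaAn W₂ * shaAn W₁ * ((m : ℂ) ^ 2 * ((W₀.torsionOrder : ℂ) ^ 2 * (W.torsionOrder : ℂ) ^ 2) *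
        ((W₂.tamagawaProduct : ℂ) * (W₁.tamagawaProduct : ℂ))) =
      shaAn W₀ * shaAn W * ((n : ℂ) ^ 2 * ((W₂.torsionOrder : ℂ) ^ 2 * (W₁.torsionOrder : ℂ) ^ 2) *
        ((W₀.tamagawaProduct : ℂ) * (W.tamagawaProduct : ℂ))))
    (hTo : Odd W.torsionOrder) (hTo₀ : Odd W₀.torsionOrder) (hTo₁ : Odd W₁.torsionOrder)
    (hTo₂ : Odd W₂.torsionOrder)
    (hc : padicValNat 2 (W₂.tamagawaProduct * W₁.tamagawaProduct) =
      padicValNat 2 (W₀.tamagawaProduct * W.tamagawaProduct))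
    -- base-pair certificates and Zhai's unit for the rank-`0` member `W₂`
    (hbsd : BSDp W 2) (hbsd₀ : BSDp W₀ 2)
    (hZhai : ∃ q : ℚ, W₂.leadingLCoeff = (q : ℂ) * (W₂.realPeriodRat : ℂ) ∧ q ≠ 0 ∧
      padicValRat 2 q = 0)
    (hReg₂ : W₂.regulator = 1) (hc₂ : Odd W₂.tamagawaProduct) :
    BSDp W₁ 2 ∧ BSDp W₂ 2 ∧ W₁.analyticRank = 1 ∧ W₂.analyticRank = 0 := by
  -- route A: the two Selmer transports from the printed control theorem
  have hSel₁' : Nat.card (W₁.selmerGroup 2) = Nat.card (W.selmerGroup 2) :=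
    hMR W d hd hd1 F hF hx hadd hmev h2F hreal hmodd hTq W₁ h₁
  have hSel₂' : Nat.card (W₂.selmerGroup 2) = Nat.card (W₀.selmerGroup 2) :=
    hMR W₀ d hd hd1 F hF hx hadd₀ hmev₀ h2F hreal₀ hmodd₀ hTq₀ W₂ h₂'
  have hSel₁ : Nat.card (W₁.selmerGroup ((2 : ℕ) : ℤ)) = Nat.card (W.selmerGroup ((2 : ℕ) : ℤ)) := by
    simpa only [Nat.cast_ofNat] using hSel₁'
  have hSel₂ : Nat.card (W₂.selmerGroup ((2 : ℕ) : ℤ)) = Nat.card (W₀.selmerGroup ((2 : ℕ) : ℤ)) := by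
    simpa only [Nat.cast_ofNat] using hSel₂'
  exact bsdp_two_genusPair_rankOne_noFlip W W₀ W₁ W₂ hmod hE hpar hGZK hd4 hD4 hsqf hgcd hχ h₁ h₂ hr
    hr₀ hsign hGZ hSel₁ hSel₂ hT hT₀ hT₁ hT₂ hSha hSha₀ hn hm hId hTo hTo₀ hTo₁ hTo₂ hc hbsd hbsd₀
    hZhai hReg₂ hc₂

end Summit.BirchSwinnertonDyer.Uniform.U2

end
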